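import Summits.Schanuel.Schanuel.Theorems.DiophantineDichotomyKhovanskiiApproxTypeEvRareFieldDefs
import Literature.NumberTheory.Automorphic.RootProductRetraction
import HarnessLib

/-!
# Stub `stub_lwPointFree` of line `rare-field-species` — crux `KhovanskiiApproxTypeEv`
# (stmt-Schanuel-14972): LINDEMANN–WEIERSTRASS POINTS ARE FREE KHOVANSKII POINTS

Route `DiophantineDichotomy` (sub-problem `Schanuel/Schanuel`), line lead
`prover-line-stmt-Schanuel-14972-a4-0`, support skeleton
`Cruxes/KhovanskiiApproxTypeEv/Lines/rare_field_species.lean`, vocabulary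
`Theorems/DiophantineDichotomyKhovanskiiApproxTypeEvRareFieldDefs.lean` (p136201).

`LWPointFree`: every `s ∈ ℚ̄ⁿ` (all coordinates algebraic over `ℚ`) is a free Khovanskii point
(`IsFreeKhovanskii n s`), i.e. a non-degenerate zero of a Khovanskii system over `ℚ`.  It is used by
the certificate `khovanskiiApproxTypeEv_iff_threeLayers` only: the naive Lindemann–Weierstrass layer
`EvLW n` of the crux quantifies over algebraic points, the crux over free Khovanskii points.

Proof (the docstring derivation of `LWPointFree`, verbatim): take the system WITHOUT `y`-variables
`gᵢ := minpoly_ℚ(sᵢ)(zᵢ)` (Mathlib's `Polynomial.toMvPolynomial (Sum.inl i)`).  It vanishes at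
`θ = (s, e^s)` because `gᵢ(θ) = minpoly(sᵢ)(sᵢ) = 0` (`MvPolynomial.aeval_toMvPolynomial`,
`minpoly.aeval`), and its exponential Jacobian `(∂_{z_j} gᵢ + y_j ∂_{y_j} gᵢ)(θ)` is the DIAGONAL
matrix `diag(minpolyᵢ′(sᵢ))` (`Literature.NumberTheory.Automorphic.pderiv_toMvPolynomial`:
`∂_j f(X_i) = δ_{ij} f′(X_i)`, so the `y`-derivatives vanish identically), whose determinant
`∏ᵢ minpolyᵢ′(sᵢ)` (`Matrix.det_diagonal`) is non-zero factor by factor: `minpoly ℚ (s i)` is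
irreducible (`minpoly.irreducible`), hence separable in characteristic `0` (`Irreducible.separable`),
hence its derivative does not vanish at its root (`Polynomial.Separable.aeval_derivative_ne_zero`).
The corner `n = 0` is the empty product.  Pattern: `isFreeKhovanskii_const_one`
(`Theorems/KhovanskiiApproxType/Negative/LoadBearing.lean`).
-/

noncomputable section

-- `Summit.Schanuel.Schanuel.…` is the mandated summit/sub-problem namespace (single-conjunct summit), hence:
set_option linter.dupNamespace false

namespace Summit.Schanuel.Schanuel.Cruxes.KhovanskiiApproxTypeEv.RareFieldSpecies

open Summit.Schanuel.Schanuel.Cruxes.KhovanskiiApproxType.LwSmallHeight (IsFreeKhovanskii)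
open Literature.NumberTheory.Automorphic (pderiv_toMvPolynomial)

/-- Separability in characteristic `0`: the derivative of the minimal polynomial over `ℚ` of an
algebraic complex number does not vanish at that number. [folklore] -/
theorem aeval_derivative_minpoly_ne_zero {x : ℂ} (hx : IsAlgebraic ℚ x) :
    Polynomial.aeval x (Polynomial.derivative (minpoly ℚ x)) ≠ 0 :=
  (minpoly.irreducible hx.isIntegral).separable.aeval_derivative_ne_zero (minpoly.aeval ℚ x)

/-- The exponential Jacobian of a Khovanskii system WITHOUT `y`-variables, `gᵢ := Pᵢ(zᵢ)`, at any
point `θ` of `ℂ²ⁿ` is the diagonal matrix `diag(Pᵢ′(θ (inl i)))`: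
`(∂_{z_j} gᵢ + y_j ∂_{y_j} gᵢ)(θ) = δ_{ij} Pᵢ′(θ_{z_i})`. [folklore] -/
theorem aeval_jacobianEntry_toMvPolynomial {n : ℕ} (P : Fin n → Polynomial ℚ)
    (θ : Fin n ⊕ Fin n → ℂ) (i j : Fin n) :
    MvPolynomial.aeval θ
        (MvPolynomial.pderiv (Sum.inl j) ((P i).toMvPolynomial (Sum.inl i)) +
          MvPolynomial.X (Sum.inr j) *
            MvPolynomial.pderiv (Sum.inr j) ((P i).toMvPolynomial (Sum.inl i))) =
      Matrix.diagonal (fun k => Polynomial.aeval (θ (Sum.inl k)) (Polynomial.derivative (P k)))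
        i j := by
  rw [pderiv_toMvPolynomial (Sum.inl i) (Sum.inl j), pderiv_toMvPolynomial (Sum.inl i) (Sum.inr j),
    if_neg Sum.inl_ne_inr, mul_zero, add_zero]
  by_cases hij : i = j
  · subst hij
    rw [if_pos rfl, Matrix.diagonal_apply_eq, MvPolynomial.aeval_toMvPolynomial]
  · rw [if_neg fun h => hij (Sum.inl_injective h), map_zero, Matrix.diagonal_apply_ne _ hij]

/-- **Stub `stub_lwPointFree` (`LWPointFree`): Lindemann–Weierstrass points are free Khovanskii
points.**  Every `s ∈ ℂⁿ` with all coordinates algebraic over `ℚ` is a non-degenerate zero of the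
Khovanskii system `gᵢ = minpoly_ℚ(sᵢ)(zᵢ)`: the exponential Jacobian at `θ = (s, e^s)` is
`diag(minpolyᵢ′(sᵢ))`, with non-zero determinant by separability in characteristic `0`. -/
theorem stub_lwPointFree : LWPointFree := by
  intro n s halg
  refine ⟨fun i => (minpoly ℚ (s i)).toMvPolynomial (Sum.inl i), fun i => ?_, ?_⟩
  · rw [MvPolynomial.aeval_toMvPolynomial, Sum.elim_inl, minpoly.aeval]
  · have hM : (Matrix.of fun i j => MvPolynomial.aeval (Sum.elim s (Complex.exp ∘ s))
        (MvPolynomial.pderiv (Sum.inl j) ((minpoly ℚ (s i)).toMvPolynomial (Sum.inl i)) +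
          MvPolynomial.X (Sum.inr j) *
            MvPolynomial.pderiv (Sum.inr j) ((minpoly ℚ (s i)).toMvPolynomial (Sum.inl i)))) =
        Matrix.diagonal fun k =>
          Polynomial.aeval (s k) (Polynomial.derivative (minpoly ℚ (s k))) := by
      ext i j
      exact aeval_jacobianEntry_toMvPolynomial (fun k => minpoly ℚ (s k)) _ i j
    rw [hM, Matrix.det_diagonal]
    exact Finset.prod_ne_zero_iff.mpr fun i _ => aeval_derivative_minpoly_ne_zero (halg i)

end Summit.Schanuel.Schanuel.Cruxes.KhovanskiiApproxTypeEv.RareFieldSpecies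

end
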